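import Mathlib
import HarnessLib

/-!
# [OURS · L1 W4.5(b)] HILBERT–BURCH, PART 1 — THE COMPLEX `A^t -M→ A^{t+1} -Δ→ A` OF A `(t+1) × t` MATRIX AND ITS
# EXACTNESS IN THE MIDDLE FROM A REGULAR PAIR IN THE IDEAL OF MAXIMAL MINORS (rung v6′ «DET-nose», ring core)
# (crux `EquisingularLiftNatThree` = stmt-ResolutionOfSingularities-20148, parent `EquisingularLiftNat` = stmt-20038,
# line `sections`, research residue `stub_elnat_three_nonisolated_nonci`)

NOT a statement of any manuscript. Helper file of the chain res-L1-w45b (cell `res-hironaka`, rung L, slot W4.5(b));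
AI-written, weaker than expert review; filed `--supports stmt-ResolutionOfSingularities-20148 --as helper`.

WHERE IT SITS (res-L1-w45b-lead-2 LEAD-MEMO-5 e186de0624463c55 §B rung v6′ / §C DEALABLE (i), 2026-08-27T09:13:54Z):
the non-isolated residue of EL♮(3) asks for UPSTAIRS lifts of the nose centre `Σ ⊂ H ⊂ ℙ³_k`. For an arithmetically
Cohen–Macaulay (determinantal) curve `Σ = V(I_t(M̄))`, `M̄` a `(t+1) × t` matrix of forms whose Hilbert–Burch complex is
exact, ANY entrywise lift `M` of `M̄` to `O[x]` gives an `O`-flat family `O[x]/I_t(M)` with special fibre `k[x]/I_t(M̄)`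
(sequel file `…NatHilbertBurchLift.lean`). THIS file is the exactness half, for an ARBITRARY commutative ring `A`.

Throughout `M : Matrix (Fin (t+1)) (Fin t) A`; its maximal minors are `Δᵢ(M) := det (M.submatrix i.succAbove id)`
(delete row `i`), `I_t(M) := Ideal.span (range Δ(M))`, and the Hilbert–Burch functional of a vector `c : Fin (t+1) → A`
is the AUGMENTED DETERMINANT `det [M | c] = det (Matrix.of fun i => Fin.snoc (M i) (c i))`.
* `det_of_snoc_eq_sum` — Laplace: `det [M | c] = ∑ᵢ (-1)^(i+t) cᵢ Δᵢ(M)`; `det_of_snoc_col_eq_zero`,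
  `sum_minor_mulVec_eq_zero`, `det_of_snoc_mulVec_eq_zero` — the functional kills the columns of `M` (`Δ ∘ M = 0`);
  `sum_minor_mem_span`, `exists_sum_minor_eq_of_mem_span`, `exists_det_of_snoc_eq_of_mem_span` — its image is `I_t(M)`.
* `mulVec_of_snoc` + **`exists_mulVec_eq_det_sq_smul`** — ADJUGATE TRICK: if `det [M | c] = 0` then
  `det [M | e]² • c ∈ im M` for every `e`; hence (`exists_mulVec_eq_sq_smul_of_mem_span`) `x² • c ∈ im M` for every
  `x ∈ I_t(M)`.
* `smul_eq_zero_of_mulVec_eq_zero`, `mulVec_eq_zero_imp_eq_zero`, `mulVec_injective_of_mem_nonZeroDivisors` — `I_t(M)`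
  kills `ker M`; so `M` is injective as soon as `I_t(M)` contains a non-zero-divisor (grade ≥ 1 half of Hilbert–Burch).
* `mem_span_pow_of_mul_mem_span_pow`, `mem_span_pow_of_pow_mul_mem_span_pow` — powers of a regular pair stay regular.
* **`exists_mulVec_eq_of_det_snoc_eq_zero`** — HILBERT–BURCH MIDDLE EXACTNESS: if `I_t(M)` contains `a, b` with `a` a
  non-zero-divisor of `A` and `b` a non-zero-divisor on `A/(a)`, then every `c` with `det [M | c] = 0` is `M w`.

References: D. Eisenbud, *Commutative Algebra with a View Toward Algebraic Geometry* (GTM 150, 1995), Thm. 20.15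
(Hilbert–Burch) and Thm. 20.9 (Buchsbaum–Eisenbud); W. Bruns–J. Herzog, *Cohen–Macaulay Rings* (1993), Thm. 1.4.17.
The proofs below are elementary (adjugates + a length-2 regular sequence) and do not use these sources.
res-L1-w45b-lead-2 LEAD-MEMO-5 (OURS planning text, index only).
-/

set_option linter.dupNamespace false -- mandated namespace `Summit.<Summit>.<Problem>` of this single-conjunct summit

namespace Summit.ResolutionOfSingularities.ResolutionOfSingularities.Cruxes.EquisingularLiftNat.Sections

open Matrix

universe u v

section HilbertBurch

variable {A : Type u} [CommRing A] {t : ℕ}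

/-! ## The Hilbert–Burch functional `c ↦ det [M | c]` -/

/-- **Laplace expansion along the appended column.** For `M : A^{(t+1) × t}` and `c ∈ A^{t+1}`,
`det [M | c] = ∑ᵢ (-1)^(i+t) · cᵢ · Δᵢ(M)` with `Δᵢ(M) = det (M minus row i)`. [folklore] [OURS · L1 W4.5b] -/
theorem det_of_snoc_eq_sum (M : Matrix (Fin (t + 1)) (Fin t) A) (c : Fin (t + 1) → A) :
    (Matrix.of fun i => (Fin.snoc (M i) (c i) : Fin (t + 1) → A)).det =
      ∑ i : Fin (t + 1), (-1) ^ ((i : ℕ) + t) * c i * (M.submatrix i.succAbove id).det := by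
  rw [Matrix.det_succ_column _ (Fin.last t)]
  refine Finset.sum_congr rfl fun i _ => ?_
  have h1 : (Matrix.of fun i => (Fin.snoc (M i) (c i) : Fin (t + 1) → A)) i (Fin.last t) = c i := by
    simp only [Matrix.of_apply, Fin.snoc_last]
  have h2 : (Matrix.of fun i => (Fin.snoc (M i) (c i) : Fin (t + 1) → A)).submatrix i.succAbove
      (Fin.last t).succAbove = M.submatrix i.succAbove id := by
    ext k l
    simp only [Matrix.submatrix_apply, Matrix.of_apply, Fin.succAbove_last, Fin.snoc_castSucc, id]
  rw [h1, h2, Fin.val_last]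

/-- `det [M | (column j of M)] = 0` (two equal columns). [folklore] [OURS · L1 W4.5b] -/
theorem det_of_snoc_col_eq_zero (M : Matrix (Fin (t + 1)) (Fin t) A) (j : Fin t) :
    (Matrix.of fun i => (Fin.snoc (M i) (M i j) : Fin (t + 1) → A)).det = 0 := by
  refine Matrix.det_zero_of_column_eq (i := Fin.castSucc j) (j := Fin.last t)
    (Fin.castSucc_lt_last j).ne ?_
  intro k
  simp only [Matrix.of_apply, Fin.snoc_castSucc, Fin.snoc_last]

/-- The Hilbert–Burch functional kills the columns of `M`: `∑ᵢ (-1)^(i+t) M i j Δᵢ(M) = 0`.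
[folklore] [OURS · L1 W4.5b] -/
theorem sum_minor_col_eq_zero (M : Matrix (Fin (t + 1)) (Fin t) A) (j : Fin t) :
    ∑ i : Fin (t + 1), (-1) ^ ((i : ℕ) + t) * M i j * (M.submatrix i.succAbove id).det = 0 :=
  calc ∑ i : Fin (t + 1), (-1) ^ ((i : ℕ) + t) * M i j * (M.submatrix i.succAbove id).det
        = (Matrix.of fun i => (Fin.snoc (M i) (M i j) : Fin (t + 1) → A)).det :=
          (det_of_snoc_eq_sum M fun i => M i j).symm
    _ = 0 := det_of_snoc_col_eq_zero M j

/-- Linearity of the Hilbert–Burch functional in the appended column: scalars. [folklore] [OURS · L1 W4.5b] -/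
theorem sum_minor_smul (M : Matrix (Fin (t + 1)) (Fin t) A) (a : A) (c : Fin (t + 1) → A) :
    ∑ i : Fin (t + 1), (-1) ^ ((i : ℕ) + t) * (a • c) i * (M.submatrix i.succAbove id).det =
      a * ∑ i : Fin (t + 1), (-1) ^ ((i : ℕ) + t) * c i * (M.submatrix i.succAbove id).det := by
  rw [Finset.mul_sum]
  refine Finset.sum_congr rfl fun i _ => ?_
  simp only [Pi.smul_apply, smul_eq_mul]
  ring

/-- Linearity of the Hilbert–Burch functional in the appended column: sums. [folklore] [OURS · L1 W4.5b] -/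
theorem sum_minor_add (M : Matrix (Fin (t + 1)) (Fin t) A) (c d : Fin (t + 1) → A) :
    ∑ i : Fin (t + 1), (-1) ^ ((i : ℕ) + t) * (c + d) i * (M.submatrix i.succAbove id).det =
      (∑ i : Fin (t + 1), (-1) ^ ((i : ℕ) + t) * c i * (M.submatrix i.succAbove id).det) +
        ∑ i : Fin (t + 1), (-1) ^ ((i : ℕ) + t) * d i * (M.submatrix i.succAbove id).det := by
  rw [← Finset.sum_add_distrib]
  refine Finset.sum_congr rfl fun i _ => ?_
  simp only [Pi.add_apply]
  ring

/-- **`Δ ∘ M = 0`** (the Hilbert–Burch sequence is a complex): for every `w ∈ A^t`,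
`∑ᵢ (-1)^(i+t) (M w)ᵢ Δᵢ(M) = 0`, i.e. `det [M | M w] = 0`. [folklore] [OURS · L1 W4.5b] -/
theorem sum_minor_mulVec_eq_zero (M : Matrix (Fin (t + 1)) (Fin t) A) (w : Fin t → A) :
    ∑ i : Fin (t + 1), (-1) ^ ((i : ℕ) + t) * (M *ᵥ w) i * (M.submatrix i.succAbove id).det = 0 := by
  have h : ∀ i : Fin (t + 1), (-1 : A) ^ ((i : ℕ) + t) * (M *ᵥ w) i * (M.submatrix i.succAbove id).det =
      ∑ j : Fin t, ((-1 : A) ^ ((i : ℕ) + t) * M i j * (M.submatrix i.succAbove id).det) * w j := by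
    intro i
    simp only [Matrix.mulVec, dotProduct]
    rw [Finset.mul_sum, Finset.sum_mul]
    refine Finset.sum_congr rfl fun j _ => ?_
    ring
  rw [Finset.sum_congr rfl fun i _ => h i, Finset.sum_comm]
  refine Finset.sum_eq_zero fun j _ => ?_
  rw [← Finset.sum_mul, sum_minor_col_eq_zero, zero_mul]

/-- `det [M | M w] = 0`. [folklore] [OURS · L1 W4.5b] -/
theorem det_of_snoc_mulVec_eq_zero (M : Matrix (Fin (t + 1)) (Fin t) A) (w : Fin t → A) :
    (Matrix.of fun i => (Fin.snoc (M i) ((M *ᵥ w) i) : Fin (t + 1) → A)).det = 0 := by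
  rw [det_of_snoc_eq_sum, sum_minor_mulVec_eq_zero]

/-- The values of the Hilbert–Burch functional lie in the ideal of maximal minors `I_t(M)`.
[folklore] [OURS · L1 W4.5b] -/
theorem sum_minor_mem_span (M : Matrix (Fin (t + 1)) (Fin t) A) (c : Fin (t + 1) → A) :
    ∑ i : Fin (t + 1), (-1) ^ ((i : ℕ) + t) * c i * (M.submatrix i.succAbove id).det ∈
      Ideal.span (Set.range fun i : Fin (t + 1) => (M.submatrix i.succAbove id).det) := by
  refine Ideal.sum_mem _ fun i _ => Ideal.mul_mem_left _ _ (Ideal.subset_span ⟨i, rfl⟩)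

/-- `det [M | c] ∈ I_t(M)`. [folklore] [OURS · L1 W4.5b] -/
theorem det_of_snoc_mem_span (M : Matrix (Fin (t + 1)) (Fin t) A) (c : Fin (t + 1) → A) :
    (Matrix.of fun i => (Fin.snoc (M i) (c i) : Fin (t + 1) → A)).det ∈
      Ideal.span (Set.range fun i : Fin (t + 1) => (M.submatrix i.succAbove id).det) := by
  rw [det_of_snoc_eq_sum]
  exact sum_minor_mem_span M c

/-- Every element of `I_t(M)` is a value of the Hilbert–Burch functional. [folklore] [OURS · L1 W4.5b] -/
theorem exists_sum_minor_eq_of_mem_span (M : Matrix (Fin (t + 1)) (Fin t) A) {x : A}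
    (hx : x ∈ Ideal.span (Set.range fun i : Fin (t + 1) => (M.submatrix i.succAbove id).det)) :
    ∃ c : Fin (t + 1) → A,
      ∑ i : Fin (t + 1), (-1) ^ ((i : ℕ) + t) * c i * (M.submatrix i.succAbove id).det = x := by
  obtain ⟨r, hr⟩ := Ideal.mem_span_range_iff_exists_fun.mp hx
  refine ⟨fun i => (-1) ^ ((i : ℕ) + t) * r i, ?_⟩
  rw [← hr]
  refine Finset.sum_congr rfl fun i _ => ?_
  have h1 : ((-1 : A) ^ ((i : ℕ) + t)) * ((-1 : A) ^ ((i : ℕ) + t)) = 1 := by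
    rw [← pow_add, ← two_mul, pow_mul, neg_one_sq, one_pow]
  calc (-1 : A) ^ ((i : ℕ) + t) * ((-1) ^ ((i : ℕ) + t) * r i) * (M.submatrix i.succAbove id).det
        = (((-1 : A) ^ ((i : ℕ) + t)) * ((-1 : A) ^ ((i : ℕ) + t))) * (r i * (M.submatrix i.succAbove id).det) := by
          ring
    _ = r i * (M.submatrix i.succAbove id).det := by rw [h1, one_mul]

/-- Every element of `I_t(M)` is an augmented determinant `det [M | c]`. [folklore] [OURS · L1 W4.5b] -/
theorem exists_det_of_snoc_eq_of_mem_span (M : Matrix (Fin (t + 1)) (Fin t) A) {x : A}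
    (hx : x ∈ Ideal.span (Set.range fun i : Fin (t + 1) => (M.submatrix i.succAbove id).det)) :
    ∃ c : Fin (t + 1) → A, (Matrix.of fun i => (Fin.snoc (M i) (c i) : Fin (t + 1) → A)).det = x := by
  obtain ⟨c, hc⟩ := exists_sum_minor_eq_of_mem_span M hx
  exact ⟨c, by rw [det_of_snoc_eq_sum, hc]⟩

/-! ## The adjugate trick -/

/-- The augmented square matrix `[M | e]` acts on `z ∈ A^{t+1}` as `M` on the first `t` coordinates plus
`z_last • e`. [folklore] [OURS · L1 W4.5b] -/
theorem mulVec_of_snoc (M : Matrix (Fin (t + 1)) (Fin t) A) (e z : Fin (t + 1) → A) :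
    (Matrix.of fun i => (Fin.snoc (M i) (e i) : Fin (t + 1) → A)) *ᵥ z =
      M *ᵥ (fun j => z (Fin.castSucc j)) + z (Fin.last t) • e := by
  ext i
  simp only [Matrix.mulVec, dotProduct, Matrix.of_apply, Pi.add_apply, Pi.smul_apply, smul_eq_mul]
  rw [Fin.sum_univ_castSucc]
  simp only [Fin.snoc_castSucc, Fin.snoc_last]
  ring

/-- **Adjugate trick.** If `det [M | c] = 0` then `det [M | e]² • c` is a combination of the columns of `M`, for
every `e ∈ A^{t+1}` (apply `[M | e] · adj [M | e] = det • 1` to `c`, read off the last coordinate with the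
functional). [folklore] [OURS · L1 W4.5b] -/
theorem exists_mulVec_eq_det_sq_smul (M : Matrix (Fin (t + 1)) (Fin t) A) {c : Fin (t + 1) → A}
    (hc : (Matrix.of fun i => (Fin.snoc (M i) (c i) : Fin (t + 1) → A)).det = 0) (e : Fin (t + 1) → A) :
    ∃ u : Fin t → A,
      M *ᵥ u = ((Matrix.of fun i => (Fin.snoc (M i) (e i) : Fin (t + 1) → A)).det ^ 2) • c := by
  set Q : Matrix (Fin (t + 1)) (Fin (t + 1)) A := Matrix.of fun i => (Fin.snoc (M i) (e i) : Fin (t + 1) → A)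
    with hQ
  -- `Q (adj Q c) = det Q • c`
  have h1 : Q *ᵥ (Q.adjugate *ᵥ c) = Q.det • c := by
    rw [Matrix.mulVec_mulVec, Matrix.mul_adjugate, Matrix.smul_mulVec, Matrix.one_mulVec]
  -- decompose the left-hand side
  have h2 : Q.det • c = M *ᵥ (fun j => (Q.adjugate *ᵥ c) (Fin.castSucc j)) +
      (Q.adjugate *ᵥ c) (Fin.last t) • e := by
    rw [← h1, hQ, mulVec_of_snoc]
  -- apply the functional: `λ · det Q = 0`
  have hc' : ∑ i : Fin (t + 1), (-1) ^ ((i : ℕ) + t) * c i * (M.submatrix i.succAbove id).det = 0 := by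
    rw [← det_of_snoc_eq_sum]; exact hc
  have he : ∑ i : Fin (t + 1), (-1) ^ ((i : ℕ) + t) * e i * (M.submatrix i.succAbove id).det = Q.det := by
    rw [← det_of_snoc_eq_sum]
  have h3 := congrArg
    (fun v : Fin (t + 1) → A => ∑ i : Fin (t + 1), (-1) ^ ((i : ℕ) + t) * v i * (M.submatrix i.succAbove id).det) h2
  rw [sum_minor_smul, sum_minor_add, sum_minor_smul, sum_minor_mulVec_eq_zero, hc', he, mul_zero,
    zero_add] at h3
  -- h3 : 0 = λ * det Q
  refine ⟨Q.det • fun j => (Q.adjugate *ᵥ c) (Fin.castSucc j), ?_⟩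
  rw [Matrix.mulVec_smul, sq, ← smul_smul, h2, smul_add, smul_smul, mul_comm, ← h3, zero_smul, add_zero]

/-- **`I_t(M)² · ker Δ ⊆ im M`.** If `det [M | c] = 0` and `x ∈ I_t(M)` then `x² • c = M u` for some `u`.
[folklore] [OURS · L1 W4.5b] -/
theorem exists_mulVec_eq_sq_smul_of_mem_span (M : Matrix (Fin (t + 1)) (Fin t) A) {c : Fin (t + 1) → A}
    (hc : (Matrix.of fun i => (Fin.snoc (M i) (c i) : Fin (t + 1) → A)).det = 0) {x : A}
    (hx : x ∈ Ideal.span (Set.range fun i : Fin (t + 1) => (M.submatrix i.succAbove id).det)) :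
    ∃ u : Fin t → A, M *ᵥ u = (x ^ 2) • c := by
  obtain ⟨e, he⟩ := exists_det_of_snoc_eq_of_mem_span M hx
  obtain ⟨u, hu⟩ := exists_mulVec_eq_det_sq_smul M hc e
  exact ⟨u, by rw [hu, he]⟩

/-- **`I_t(M)` kills `ker M`.** If `M w = 0` then `x • w = 0` for every `x ∈ I_t(M)` (adjugate of `[M | e]`
applied to `(w, 0)`). [folklore] [OURS · L1 W4.5b] -/
theorem smul_eq_zero_of_mulVec_eq_zero (M : Matrix (Fin (t + 1)) (Fin t) A) {w : Fin t → A}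
    (hw : M *ᵥ w = 0) {x : A}
    (hx : x ∈ Ideal.span (Set.range fun i : Fin (t + 1) => (M.submatrix i.succAbove id).det)) :
    x • w = 0 := by
  obtain ⟨e, he⟩ := exists_det_of_snoc_eq_of_mem_span M hx
  set Q : Matrix (Fin (t + 1)) (Fin (t + 1)) A := Matrix.of fun i => (Fin.snoc (M i) (e i) : Fin (t + 1) → A)
    with hQ
  have h1 : Q *ᵥ (Fin.snoc w 0 : Fin (t + 1) → A) = 0 := by
    rw [hQ, mulVec_of_snoc]
    have h2 : (fun j : Fin t => (Fin.snoc w 0 : Fin (t + 1) → A) (Fin.castSucc j)) = w := by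
      funext j; simp only [Fin.snoc_castSucc]
    rw [h2, hw, Fin.snoc_last, zero_smul, add_zero]
  have h3 : Q.det • (Fin.snoc w 0 : Fin (t + 1) → A) = 0 := by
    rw [← Matrix.one_mulVec (Fin.snoc w 0 : Fin (t + 1) → A), ← Matrix.smul_mulVec, ← Matrix.adjugate_mul,
      ← Matrix.mulVec_mulVec, h1, Matrix.mulVec_zero]
  rw [he] at h3
  funext j
  have h4 := congrFun h3 (Fin.castSucc j)
  simp only [Pi.smul_apply, Fin.snoc_castSucc, Pi.zero_apply] at h4
  simpa only [Pi.smul_apply, Pi.zero_apply] using h4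

/-- **Grade ≥ 1 ⇒ `M` injective** (first half of Hilbert–Burch): if `I_t(M)` contains a non-zero-divisor then
`M w = 0 ⇒ w = 0`. [folklore] [OURS · L1 W4.5b] -/
theorem mulVec_eq_zero_imp_eq_zero (M : Matrix (Fin (t + 1)) (Fin t) A) {a : A}
    (haI : a ∈ Ideal.span (Set.range fun i : Fin (t + 1) => (M.submatrix i.succAbove id).det))
    (ha : a ∈ nonZeroDivisors A) {w : Fin t → A} (hw : M *ᵥ w = 0) : w = 0 := by
  have h := smul_eq_zero_of_mulVec_eq_zero M hw haI
  funext j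
  have hj := congrFun h j
  simp only [Pi.smul_apply, smul_eq_mul, Pi.zero_apply] at hj
  exact (mem_nonZeroDivisors_iff.mp ha).1 _ hj

/-- **Grade ≥ 1 ⇒ `M` injective**, `Function.Injective` form. [folklore] [OURS · L1 W4.5b] -/
theorem mulVec_injective_of_mem_nonZeroDivisors (M : Matrix (Fin (t + 1)) (Fin t) A) {a : A}
    (haI : a ∈ Ideal.span (Set.range fun i : Fin (t + 1) => (M.submatrix i.succAbove id).det))
    (ha : a ∈ nonZeroDivisors A) : Function.Injective fun w : Fin t → A => M *ᵥ w := by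
  intro w w' h
  have h' : M *ᵥ (w - w') = 0 := by
    simp only at h
    rw [Matrix.mulVec_sub, h, sub_self]
  exact sub_eq_zero.mp (mulVec_eq_zero_imp_eq_zero M haI ha h')

/-! ## Powers of a length-two regular sequence -/

/-- If `a` is a non-zero-divisor and `b` is a non-zero-divisor modulo `a`, then `b` is a non-zero-divisor modulo
`aⁿ`. [folklore] [OURS · L1 W4.5b] -/
theorem mem_span_pow_of_mul_mem_span_pow {a b : A} (ha : a ∈ nonZeroDivisors A)
    (hb : ∀ y : A, b * y ∈ Ideal.span {a} → y ∈ Ideal.span {a}) (n : ℕ) :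
    ∀ y : A, b * y ∈ Ideal.span {a ^ n} → y ∈ Ideal.span {a ^ n} := by
  induction n with
  | zero => intro y _; simp
  | succ n ih =>
    intro y hy
    -- `b y ∈ (a^{n+1}) ⊆ (a)` so `y = y' a`
    have hy1 : b * y ∈ Ideal.span {a} := by
      refine Ideal.span_singleton_le_span_singleton.mpr ?_ hy
      exact Dvd.intro_left _ (pow_succ a n).symm
    obtain ⟨y', rfl⟩ := Ideal.mem_span_singleton'.mp (hb y hy1)
    obtain ⟨z, hz⟩ := Ideal.mem_span_singleton'.mp hy
    -- `b y' a = z a^n a` ⇒ `b y' = z a^n ∈ (a^n)` ⇒ `y' ∈ (a^n)`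
    have h1 : (b * y' - z * a ^ n) * a = 0 := by
      rw [sub_mul, mul_assoc, ← hz, pow_succ, mul_assoc, sub_self]
    have h2 : b * y' = z * a ^ n := sub_eq_zero.mp ((mul_right_mem_nonZeroDivisors_eq_zero_iff ha).mp h1)
    have h3 : y' ∈ Ideal.span {a ^ n} := ih y' (Ideal.mem_span_singleton'.mpr ⟨z, h2.symm⟩)
    obtain ⟨y'', rfl⟩ := Ideal.mem_span_singleton'.mp h3
    exact Ideal.mem_span_singleton'.mpr ⟨y'', by rw [pow_succ, mul_assoc]⟩

/-- If `a` is a non-zero-divisor and `b` is a non-zero-divisor modulo `a`, then `bᵐ` is a non-zero-divisor modulo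
`aⁿ` (powers of a regular sequence of length two form a regular sequence). [folklore] [OURS · L1 W4.5b] -/
theorem mem_span_pow_of_pow_mul_mem_span_pow {a b : A} (ha : a ∈ nonZeroDivisors A)
    (hb : ∀ y : A, b * y ∈ Ideal.span {a} → y ∈ Ideal.span {a}) (n m : ℕ) :
    ∀ y : A, b ^ m * y ∈ Ideal.span {a ^ n} → y ∈ Ideal.span {a ^ n} := by
  induction m with
  | zero => intro y hy; simpa using hy
  | succ m ih =>
    intro y hy
    have h1 : b ^ m * (b * y) ∈ Ideal.span {a ^ n} := by
      rw [← mul_assoc, ← pow_succ]; exact hy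
    exact mem_span_pow_of_mul_mem_span_pow ha hb n y (ih (b * y) h1)

/-! ## Hilbert–Burch: exactness in the middle from grade two -/

/-- **HILBERT–BURCH (exactness of `A^t -M→ A^{t+1} -Δ→ A` in the middle).** Let `M : A^{(t+1) × t}` and suppose its
ideal of maximal minors `I_t(M)` contains `a, b` with `a` a non-zero-divisor of `A` and `b` a non-zero-divisor of
`A/(a)` (grade `I_t(M) ≥ 2`). Then every `c ∈ A^{t+1}` with `det [M | c] = 0` is of the form `M w`.
Proof: `a² c = M u`, `b² c = M v` (adjugate trick), `M (b² u - a² v) = 0 ⇒ b² u = a² v` (injectivity) `⇒ u ∈ a² A^t`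
(regular sequence) `⇒ c = M (u / a²)`. [Eisenbud GTM 150 Thm. 20.15; elementary proof OURS] [OURS · L1 W4.5b] -/
theorem exists_mulVec_eq_of_det_snoc_eq_zero (M : Matrix (Fin (t + 1)) (Fin t) A) {a b : A}
    (haI : a ∈ Ideal.span (Set.range fun i : Fin (t + 1) => (M.submatrix i.succAbove id).det))
    (hbI : b ∈ Ideal.span (Set.range fun i : Fin (t + 1) => (M.submatrix i.succAbove id).det))
    (ha : a ∈ nonZeroDivisors A) (hb : ∀ y : A, b * y ∈ Ideal.span {a} → y ∈ Ideal.span {a})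
    (c : Fin (t + 1) → A) (hc : (Matrix.of fun i => (Fin.snoc (M i) (c i) : Fin (t + 1) → A)).det = 0) :
    ∃ w : Fin t → A, M *ᵥ w = c := by
  obtain ⟨u, hu⟩ := exists_mulVec_eq_sq_smul_of_mem_span M hc haI
  obtain ⟨v, hv⟩ := exists_mulVec_eq_sq_smul_of_mem_span M hc hbI
  -- `M (b² u - a² v) = 0`
  have h1 : M *ᵥ (b ^ 2 • u - a ^ 2 • v) = 0 := by
    rw [Matrix.mulVec_sub, Matrix.mulVec_smul, Matrix.mulVec_smul, hu, hv, smul_smul, smul_smul, mul_comm,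
      sub_self]
  have h2 : b ^ 2 • u - a ^ 2 • v = 0 := mulVec_eq_zero_imp_eq_zero M haI ha h1
  -- coordinatewise: `b² u_j = a² v_j ∈ (a²)` ⇒ `u_j ∈ (a²)`
  have h3 : ∀ j : Fin t, ∃ u' : A, u' * a ^ 2 = u j := by
    intro j
    have hj := congrFun h2 j
    simp only [Pi.sub_apply, Pi.smul_apply, smul_eq_mul, Pi.zero_apply] at hj
    have hj' : b ^ 2 * u j ∈ Ideal.span {a ^ 2} :=
      Ideal.mem_span_singleton'.mpr ⟨v j, by rw [sub_eq_zero] at hj; rw [hj, mul_comm]⟩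
    exact Ideal.mem_span_singleton'.mp (mem_span_pow_of_pow_mul_mem_span_pow ha hb 2 2 (u j) hj')
  choose u' hu' using h3
  refine ⟨u', ?_⟩
  -- `a² • (M u' - c) = 0`
  have h4 : a ^ 2 • (M *ᵥ u' - c) = 0 := by
    rw [smul_sub, ← Matrix.mulVec_smul, ← hu]
    have h5 : a ^ 2 • u' = u := by
      funext j; simp only [Pi.smul_apply, smul_eq_mul]; rw [mul_comm]; exact hu' j
    rw [h5, sub_self]
  have ha2 : a ^ 2 ∈ nonZeroDivisors A := pow_mem ha 2
  funext i
  have hi := congrFun h4 i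
  simp only [Pi.smul_apply, Pi.sub_apply, smul_eq_mul, Pi.zero_apply] at hi
  exact sub_eq_zero.mp ((mem_nonZeroDivisors_iff.mp ha2).1 _ hi)

end HilbertBurch

end Summit.ResolutionOfSingularities.ResolutionOfSingularities.Cruxes.EquisingularLiftNat.Sections
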